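import Summits.QuantumFields.BalabanUV.T4Continuum.Support.VariationalAssemblySlice

/-!
# T⁴ programme, spine node NE2 (U1a), lane P2 — THE GAUGE-SLICE BRACKET WITH ITS TWO `G`-BINDERS LOCALISED AT MINIMISERS: (SLICE) only AT AVERAGED FINE
# MINIMISERS, leaf V-ONE only AT COARSE MINIMISERS and INTO THE COMPOSITE FIBRE (abstract + vector letters; model level; cell `pub-balaban`)

NE2 formalisation swarm `b2b-balaban-t4-ne2-formalise-*`, leaf prover 01 GEN 7 (`prover-b2b-balaban-t4-ne2-formalise-leaf-01-g7-0`); item «V-GF WITH BACKGROUND», step 2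
(journal INTENT CLAIMS.log 2026-08-20 15:33Z, l.16197).  A sibling of leaf-09-g6's `VariationalAssemblySlice.pair_bracket_sqrt_slice` (p220652) — re-proved with TWO binders
weakened, over the road's spine BY NAME (`blockSpin_le`, `blockSpin_eq_of_isMin`, `exists_isMinOn_fib`, `defect_bound`) and p220652's vector helpers (`sqrt_form_mono`,
`SfV_zero_le`, `qWV_QvL_le_qVV`); nothing defined.

WHY (leaf-09-g7's remarks CLAIMS.log 2026-08-20 15:15Z (i) and 15:26Z (3); this seat's memo `t4/T4-EST-NE2-P2-VGF.md`).
(1) In `pair_bracket_sqrt_slice` the slice binder `hslice : ∀ f, ∃ g, …` is USED ONLY at `f = Q₁ g₀`, `g₀` a minimiser of the fine form on the composite fibre.  With background the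
unrestricted (SLICE) constant does NOT decay along the tower (memo §3: `σ⋆(n;c) ≈ 0.16·c`, level-independent — the commutator cost of `VariationalVectorGaugeMove`), whereas the
constant RESTRICTED to averaged fine minimisers is numerically zero (memo §3, `σ⋆_restr ≤ 10⁻⁶` at `c = 0.1`, d = 2): the END must ask only for
  (SLICE-min)  `∀ μ g₀, Qk (Q₁ g₀) = μ → (g₀ minimises Sf on {Qk ∘ Q₁ = μ}) → ∃ g, Qk g = μ ∧ Sc g ≤ Scc (Q₁ g₀) + σ′·Scc (Q₁ g₀) + σ·qW (Q₁ g₀)`.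
(2) The upper bracket's `hONE` asks for the ONE-STEP block-spin value of the FULL fine form `Sf` (curl + `G′`) at every coarse field; at `U = 1` the fine slice `{G′ = 0}` is NOT
reachable inside a one-step fibre once `k ≥ 1` (leaf-09-g7 (3): `ker Q′_L ⊊ ker Q′_{L^{k+1}}`), and with background the pure-curl fine form is DEGENERATE on fibres (memo §3: its fibre
infimum is numerically 0 — `R′`-curl-free fields of large size reach every datum), so neither «`hONE` for `Sf`» nor «`hONE` for the pure-curl form + a value law» is the right
socket.  What the proof USES is only: at the coarse MINIMISER `f₀`, SOME field of the COMPOSITE fibre below the one-step bracket —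
  (ONE-min)  `∀ μ f₀, Qk f₀ = μ → (f₀ minimises Sc on {Qk = μ}) → ∃ g, Qk (Q₁ g) = μ ∧ Sf g ≤ (√(Sc f₀ + ε₁ρ f₀) + δ′√(qW f₀))²`
(⇐ `hONE` by the one-step minimiser; at `U = 1` ⇐ leaf-01-g6's pure-curl competitor `blockSpin_QvV_le_flat` ∕ `SfV_interpV_le` (p220658 ∕ p219670) followed by leaf-09-g7's
zero-cost slice move IN THE COMPOSITE FIBRE one level up (`slice_flat`, p222324) — no «V-ONE-G» interpolation estimate needed; with background = V-ONE's curl half + a fine-level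
(SLICE-min)-type law at those competitors).  No surjectivity of `Q₁` and no `blockSpin_comp` are needed any more.
 * §1 **`pair_bracket_sqrt_min`** — p220652's bracket with `hslice` ↦ (SLICE-min) and `hONE` ↦ (ONE-min); BOTH defects VERBATIM
   (lower `e_F + σ′(Λ + e_F) + σ·C_P(Λ+1)`, upper `e′ = ε₁C_R(Λ+1) + 2δ′√((Λ + ε₁C_R(Λ+1))·C_P(Λ+1)) + δ′²C_P(Λ+1)`);
 * §2 vector letters: **`vector_pair_bracket_sqrt_min_line`** (`Sc := ScV R G`, `Scc := ScV R 0`, `Sf := SfV R′ G′`, `Q₁ := QvL L (fine n M) T′`, `hQ₁size` discharged, curl Federbush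
   against `SfV R′ 0`).
For the U = 1 END (leaf-10-g3's `VariationalVectorEndFlat`, INTENT 15:19Z): (SLICE-min) ⇐ `hslice_tower` (σ = σ′ = 0) trivially; (ONE-min) as in (2) — the displayed V-ONE socket of
the flat END becomes dischargeable from landed files.  With background both binders are exactly the located numbers of the memo.

HONEST FRAMING (T4-DAG p. 1).  Abstract bookkeeping on `blockSpin` at MODEL level; every leaf ∕ law is a DISPLAYED binder, none discharged here; [folklore]; nothing printed is
a hypothesis; no `def`, no `def … : Prop`, no `sorry`; axioms standard.  V-GF with background OPEN; V-END ∕ NE2 NOT proved; NE3 OPEN; spine PROVED 0∕9 unchanged; rung (B)+1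
finite T⁴ — NOT infinite volume, NOT mass gap, NOT Clay.  HONEST DEPENDENCY (cell, verbatim): continuum YM on T⁴ ⇐ BetaPertH ∧ nine spine estimates (0/9 proved); BetaPertH ⇐
(D1) ∧ (D4) ∧ CAP+tail; G-an2-4 gates asym, D1 and NE2/3/4.
-/

noncomputable section

namespace Summit.QuantumFields.BalabanUV.T4Continuum.VariationalAssemblySliceMin

open Finset
open Literature.MathematicalPhysics.QuantumFieldTheory.Balaban1983to89.B5Prop11Plancherel (Tor fine unitVec)
open Summit.QuantumFields.BalabanUV.T4Continuum.VariationalTransfer (blockSpin blockSpin_le blockSpin_eq_of_isMin)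
open Summit.QuantumFields.BalabanUV.T4Continuum.VariationalCovariantAssembly (exists_isMinOn_fib defect_bound)
open Summit.QuantumFields.BalabanUV.T4Continuum.VectorBlockTrialForm (nsqV nsqV_nonneg QvL)
open Summit.QuantumFields.BalabanUV.T4Continuum.VariationalVectorForm
open Summit.QuantumFields.BalabanUV.T4Continuum.VariationalVectorAverage (nsqV_QvL_le_qWV continuous_QvL)
open Summit.QuantumFields.BalabanUV.T4Continuum.VariationalAssemblySlice (sqrt_form_mono SfV_zero_le qWV_QvL_le_qVV)

/-! ## §1 The abstract bracket with (SLICE-min) and (ONE-min) -/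

section Abstract

variable {V W Z : Type*} [NormedAddCommGroup V] [ProperSpace V] [NormedAddCommGroup W] [ProperSpace W] [TopologicalSpace Z] [T1Space Z]

/-- **THE GAUGE-SLICE BRACKET WITH ITS `G`-BINDERS LOCALISED AT MINIMISERS**: `pair_bracket_sqrt_slice` (p220652) with (i) the slice law required ONLY at averaged fine
minimisers ((SLICE-min): for every `μ` and every minimiser `g₀` of `Sf` on `{Qk ∘ Q₁ = μ}`, some `g` with `Qk g = μ` and `Sc g ≤ (1+σ′)·Scc (Q₁ g₀) + σ·qW (Q₁ g₀)`), and (ii) leaf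
ONE required ONLY at coarse minimisers and INTO THE COMPOSITE FIBRE ((ONE-min): for every minimiser `f₀` of `Sc` on `{Qk = μ}`, some `g` with `Qk (Q₁ g) = μ` and
`Sf g ≤ (√(Sc f₀ + ε₁ρ f₀) + δ′√(qW f₀))²`).  Conclusions VERBATIM: lower defect `e_F + σ′(Λ + e_F) + σ·C_P(Λ+1)`, upper defect
`e′ = ε₁C_R(Λ+1) + 2δ′√((Λ + ε₁C_R(Λ+1))·C_P(Λ+1)) + δ′²C_P(Λ+1)`; no surjectivity of `Q₁` is needed. [folklore] -/
theorem pair_bracket_sqrt_min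
    {Qk : W → Z} {Q₁ : V → W} {Sc Scc : W → ℝ} {Sf : V → ℝ} {qW : W → ℝ} {qV : V → ℝ} {qZ : Z → ℝ} {ρ : W → ℝ}
    (hQk : Continuous Qk) (hQ₁ : Continuous Q₁) (hSc : Continuous Sc) (hSf : Continuous Sf)
    (hSc0 : ∀ f, 0 ≤ Sc f) (hSf0 : ∀ f', 0 ≤ Sf f') (hqV0 : ∀ f', 0 ≤ qV f') (hqW0 : ∀ f, 0 ≤ qW f) (hqZ0 : ∀ μ, 0 ≤ qZ μ)
    (hρ0 : ∀ f, 0 ≤ ρ f)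
    {κ Λ CP CR δ ε₁ δ' σ σ' : ℝ} (hκ : 0 ≤ κ) (hΛ : 0 ≤ Λ) (hCP : 0 ≤ CP) (hCR : 0 ≤ CR) (hδ : 0 ≤ δ) (hε₁ : 0 ≤ ε₁) (hδ' : 0 ≤ δ')
    (hσ : 0 ≤ σ) (hσ' : 0 ≤ σ')
    (hnormW : ∀ f, ‖f‖ ^ 2 ≤ κ * qW f) (hnormV : ∀ f', ‖f'‖ ^ 2 ≤ κ * qV f')
    -- leaf UB at both levels
    (hUBc : ∀ μ, ∃ f, Qk f = μ ∧ Sc f ≤ Λ * qZ μ) (hUBf : ∀ μ, ∃ f', Qk (Q₁ f') = μ ∧ Sf f' ≤ Λ * qZ μ)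
    -- leaf P at both levels
    (hPc : ∀ f, qW f ≤ CP * (Sc f + qZ (Qk f))) (hPf : ∀ f', qV f' ≤ CP * (Sf f' + qZ (Qk (Q₁ f'))))
    -- Federbush for the CURL PART only, the SLICE AT AVERAGED FINE MINIMISERS, and the size contraction of the average
    (hFEDc : ∀ f', Scc (Q₁ f') ≤ (Real.sqrt (Sf f') + δ * Real.sqrt (qV f')) ^ 2)
    (hslice : ∀ μ g₀, Qk (Q₁ g₀) = μ → (∀ f', Qk (Q₁ f') = μ → Sf g₀ ≤ Sf f') →
      ∃ g, Qk g = μ ∧ Sc g ≤ Scc (Q₁ g₀) + σ' * Scc (Q₁ g₀) + σ * qW (Q₁ g₀))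
    (hQ₁size : ∀ f', qW (Q₁ f') ≤ qV f')
    -- leaf ONE at COARSE MINIMISERS into the COMPOSITE fibre, and leaf REG
    (hONEm : ∀ μ f₀, Qk f₀ = μ → (∀ f, Qk f = μ → Sc f₀ ≤ Sc f) →
      ∃ g, Qk (Q₁ g) = μ ∧ Sf g ≤ (Real.sqrt (Sc f₀ + ε₁ * ρ f₀) + δ' * Real.sqrt (qW f₀)) ^ 2)
    (hREG : ∀ μ f, Qk f = μ → (∀ g, Qk g = μ → Sc f ≤ Sc g) → ρ f ≤ CR * (Sc f + qZ μ))
    (μ : Z) :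
    blockSpin Qk Sc μ ≤ blockSpin (Qk ∘ Q₁) Sf μ
        + ((2 * δ * Real.sqrt (Λ * (CP * (Λ + 1))) + δ ^ 2 * (CP * (Λ + 1)))
            + σ' * (Λ + (2 * δ * Real.sqrt (Λ * (CP * (Λ + 1))) + δ ^ 2 * (CP * (Λ + 1)))) + σ * (CP * (Λ + 1))) * qZ μ ∧
      blockSpin (Qk ∘ Q₁) Sf μ ≤ blockSpin Qk Sc μ
        + (ε₁ * CR * (Λ + 1) + 2 * δ' * Real.sqrt ((Λ + ε₁ * CR * (Λ + 1)) * (CP * (Λ + 1))) + δ' ^ 2 * (CP * (Λ + 1))) * qZ μ := by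
  -- the coarse minimiser (P coercivity + UB nonemptiness)
  obtain ⟨fU, hfU, hfUb⟩ := hUBc μ
  obtain ⟨f₀, hf₀, hmin⟩ := exists_isMinOn_fib (qZ := qZ) hQk hSc hκ hCP hnormW hPc hfU
  -- the fine minimiser for the composite constraint
  obtain ⟨gU, hgU, hgUb⟩ := hUBf μ
  have hPf' : ∀ f', qV f' ≤ CP * (Sf f' + qZ ((Qk ∘ Q₁) f')) := fun f' => by simpa using hPf f'
  obtain ⟨g₀, hg₀, hmin'⟩ := exists_isMinOn_fib (Q := Qk ∘ Q₁) (qZ := qZ) (hQk.comp hQ₁) hSf hκ hCP hnormV hPf'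
    (f₁ := gU) (by simpa using hgU)
  have hg₀' : Qk (Q₁ g₀) = μ := by simpa using hg₀
  have hminf : ∀ f', Qk (Q₁ f') = μ → Sf g₀ ≤ Sf f' := fun f' hf' => hmin' f' (by simpa using hf')
  -- sizes of the two minimisers
  have hSf_le : Sf g₀ ≤ Λ * qZ μ := (hminf gU hgU).trans hgUb
  have hSc_le : Sc f₀ ≤ Λ * qZ μ := (hmin fU hfU).trans hfUb
  have hqV_le : qV g₀ ≤ CP * (Λ + 1) * qZ μ := by
    calc qV g₀ ≤ CP * (Sf g₀ + qZ (Qk (Q₁ g₀))) := hPf g₀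
      _ ≤ CP * (Λ * qZ μ + qZ μ) := by rw [hg₀']; gcongr
      _ = CP * (Λ + 1) * qZ μ := by ring
  have hqW_le : qW f₀ ≤ CP * (Λ + 1) * qZ μ := by
    calc qW f₀ ≤ CP * (Sc f₀ + qZ (Qk f₀)) := hPc f₀
      _ ≤ CP * (Λ * qZ μ + qZ μ) := by rw [hf₀]; gcongr
      _ = CP * (Λ + 1) * qZ μ := by ring
  have hρ_le : ρ f₀ ≤ CR * (Λ + 1) * qZ μ := by
    calc ρ f₀ ≤ CR * (Sc f₀ + qZ μ) := hREG μ f₀ hf₀ hmin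
      _ ≤ CR * (Λ * qZ μ + qZ μ) := by gcongr
      _ = CR * (Λ + 1) * qZ μ := by ring
  -- the SLICE competitor in the coarse fibre of `μ`, built from the averaged fine MINIMISER `Q₁ g₀` (the only place the slice law is used)
  obtain ⟨gs, hgs, hgsS⟩ := hslice μ g₀ hg₀' hminf
  -- curl Federbush at the fine minimiser + the slice cost: additive defect `e·qZ μ`
  set eF := 2 * δ * Real.sqrt (Λ * (CP * (Λ + 1))) + δ ^ 2 * (CP * (Λ + 1)) with heF
  have hF : Sc gs ≤ Sf g₀ + (eF + σ' * (Λ + eF) + σ * (CP * (Λ + 1))) * qZ μ := by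
    have h := hFEDc g₀
    have hdef := defect_bound (s := Sf g₀) (v := qV g₀) (z := qZ μ) (P := CP * (Λ + 1)) hδ hΛ (by positivity) (hqZ0 μ)
      hSf_le hqV_le
    rw [add_sq, Real.sq_sqrt (hSf0 g₀), mul_pow, Real.sq_sqrt (hqV0 g₀)] at h
    have hT : Scc (Q₁ g₀) ≤ Sf g₀ + eF * qZ μ := by rw [heF]; linarith
    have hT' : Scc (Q₁ g₀) ≤ (Λ + eF) * qZ μ := by nlinarith [hSf_le]
    have hσT : σ' * Scc (Q₁ g₀) ≤ σ' * ((Λ + eF) * qZ μ) := mul_le_mul_of_nonneg_left hT' hσ'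
    have hsz : σ * qW (Q₁ g₀) ≤ σ * (CP * (Λ + 1) * qZ μ) := mul_le_mul_of_nonneg_left ((hQ₁size g₀).trans hqV_le) hσ
    nlinarith [hgsS, hT, hσT, hsz]
  -- the LOWER bracket through the slice competitor
  have hlow : blockSpin Qk Sc μ ≤ blockSpin (Qk ∘ Q₁) Sf μ + (eF + σ' * (Λ + eF) + σ * (CP * (Λ + 1))) * qZ μ := by
    have hval : blockSpin (Qk ∘ Q₁) Sf μ = Sf g₀ := blockSpin_eq_of_isMin (Q := Qk ∘ Q₁) hSf0 hg₀ hmin'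
    rw [hval]
    exact (blockSpin_le hSc0 hgs).trans hF
  -- ONE at the coarse minimiser, into the composite fibre: the square-root shape becomes an additive defect `e′·qZ μ` (verbatim arithmetic)
  obtain ⟨g₁, hg₁, hONE₁⟩ := hONEm μ f₀ hf₀ hmin
  have hc : Sf g₁ ≤ Sc f₀
      + (ε₁ * CR * (Λ + 1) + 2 * δ' * Real.sqrt ((Λ + ε₁ * CR * (Λ + 1)) * (CP * (Λ + 1))) + δ' ^ 2 * (CP * (Λ + 1))) * qZ μ := by
    have h := hONE₁
    have hs0 : 0 ≤ Sc f₀ + ε₁ * ρ f₀ := add_nonneg (hSc0 f₀) (mul_nonneg hε₁ (hρ0 f₀))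
    have hs : Sc f₀ + ε₁ * ρ f₀ ≤ (Λ + ε₁ * CR * (Λ + 1)) * qZ μ := by
      nlinarith [hSc_le, mul_le_mul_of_nonneg_left hρ_le hε₁]
    have hΛ' : 0 ≤ Λ + ε₁ * CR * (Λ + 1) := by positivity
    have hdef := defect_bound (s := Sc f₀ + ε₁ * ρ f₀) (v := qW f₀) (z := qZ μ) (Λ := Λ + ε₁ * CR * (Λ + 1)) (P := CP * (Λ + 1))
      hδ' hΛ' (by positivity) (hqZ0 μ) hs hqW_le
    rw [add_sq, Real.sq_sqrt hs0, mul_pow, Real.sq_sqrt (hqW0 f₀)] at h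
    have hρ' : ε₁ * ρ f₀ ≤ ε₁ * CR * (Λ + 1) * qZ μ := by nlinarith [mul_le_mul_of_nonneg_left hρ_le hε₁]
    linarith
  refine ⟨by rw [heF] at hlow; exact hlow, ?_⟩
  -- the UPPER bracket: the composite-fibre competitor `g₁` and `Sc f₀ = Δ_k(μ)`
  rw [blockSpin_eq_of_isMin hSc0 hf₀ hmin]
  have hg₁' : (Qk ∘ Q₁) g₁ = μ := by simpa using hg₁
  exact (blockSpin_le hSf0 hg₁').trans hc

end Abstract

/-! ## §2 Vector letters: the line-indexed one-step average -/

section Vector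

variable {d : ℕ} {E : Type*} [NormedAddCommGroup E] [NormedSpace ℂ E]
variable (n L : ℕ) [NeZero n] [NeZero L] (M : Fin d → ℕ) [hM : ∀ μ, NeZero (M μ)]

/-- **THE BRACKET WITH `G`-BINDERS LOCALISED AT MINIMISERS, VECTOR CANONICAL PAIR, LINE-INDEXED ONE-STEP AVERAGE** (`E` finite-dimensional): `Sc := ScV R G`,
`Scc := ScV R 0`, `Sf := SfV R′ G′`, `Q₁ := QvL L (fine n M) T′` with contractive line transports (`hQ₁size` DISCHARGED), `Qk` DATA; (SLICE-min) at averaged fine minimisers,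
(ONE-min) at coarse minimisers into the composite fibre, the curl Federbush against `SfV R′ 0`; conclusions as in §1 (= p220652's, verbatim). [folklore] -/
theorem vector_pair_bracket_sqrt_min_line [FiniteDimensional ℂ E]
    {R : Tor (fine n M) → Fin d → (E →L[ℂ] E)} {R' : Tor (fine L (fine n M)) → Fin d → (E →L[ℂ] E)}
    {G : (Tor (fine n M) → Fin d → E) → ℝ} {G' : (Tor (fine L (fine n M)) → Fin d → E) → ℝ}
    {Qk : (Tor (fine n M) → Fin d → E) → (Tor M → Fin d → E)} {T' : Tor (fine n M) → (Fin d → Fin L) → Fin L → Fin d → (E →L[ℂ] E)}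
    (hQk : Continuous Qk) (hT' : ∀ y j t μ, ‖T' y j t μ‖ ≤ 1)
    (hG0 : ∀ W, 0 ≤ G W) (hGc : Continuous G) (hG0' : ∀ W', 0 ≤ G' W') (hGc' : Continuous G')
    {Λ CP CR δ ε₁ δ' σ σ' : ℝ} (hΛ : 0 ≤ Λ) (hCP : 0 ≤ CP) (hCR : 0 ≤ CR) (hδ : 0 ≤ δ) (hε₁ : 0 ≤ ε₁) (hδ' : 0 ≤ δ') (hσ : 0 ≤ σ)
    (hσ' : 0 ≤ σ') {ρ : (Tor (fine n M) → Fin d → E) → ℝ} (hρ0 : ∀ W, 0 ≤ ρ W)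
    (hUBc : ∀ φ : Tor M → Fin d → E, ∃ W, Qk W = φ ∧ ScV n M R G W ≤ Λ * nsqV M φ)
    (hUBf : ∀ φ : Tor M → Fin d → E, ∃ W', Qk (QvL L (fine n M) T' W') = φ ∧ SfV n L M R' G' W' ≤ Λ * nsqV M φ)
    (hPc : ∀ W, qWV n M W ≤ CP * (ScV n M R G W + nsqV M (Qk W)))
    (hPf : ∀ W', qVV n L M W' ≤ CP * (SfV n L M R' G' W' + nsqV M (Qk (QvL L (fine n M) T' W'))))
    (hFEDcurl : ∀ W', ScV n M R (fun _ => 0) (QvL L (fine n M) T' W')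
      ≤ (Real.sqrt (SfV n L M R' (fun _ => 0) W') + δ * Real.sqrt (qVV n L M W')) ^ 2)
    (hslice : ∀ (φ : Tor M → Fin d → E) (g₀ : Tor (fine L (fine n M)) → Fin d → E), Qk (QvL L (fine n M) T' g₀) = φ →
      (∀ W', Qk (QvL L (fine n M) T' W') = φ → SfV n L M R' G' g₀ ≤ SfV n L M R' G' W') →
      ∃ Ws, Qk Ws = φ ∧ ScV n M R G Ws ≤ ScV n M R (fun _ => 0) (QvL L (fine n M) T' g₀)
        + σ' * ScV n M R (fun _ => 0) (QvL L (fine n M) T' g₀) + σ * qWV n M (QvL L (fine n M) T' g₀))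
    (hONEm : ∀ (φ : Tor M → Fin d → E) (W₀ : Tor (fine n M) → Fin d → E), Qk W₀ = φ → (∀ W, Qk W = φ → ScV n M R G W₀ ≤ ScV n M R G W) →
      ∃ g, Qk (QvL L (fine n M) T' g) = φ ∧ SfV n L M R' G' g ≤ (Real.sqrt (ScV n M R G W₀ + ε₁ * ρ W₀) + δ' * Real.sqrt (qWV n M W₀)) ^ 2)
    (hREG : ∀ (φ : Tor M → Fin d → E) W, Qk W = φ → (∀ W₂, Qk W₂ = φ → ScV n M R G W ≤ ScV n M R G W₂) →
      ρ W ≤ CR * (ScV n M R G W + nsqV M φ))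
    (φ : Tor M → Fin d → E) :
    blockSpin Qk (ScV n M R G) φ ≤ blockSpin (Qk ∘ QvL L (fine n M) T') (SfV n L M R' G') φ
        + ((2 * δ * Real.sqrt (Λ * (CP * (Λ + 1))) + δ ^ 2 * (CP * (Λ + 1)))
            + σ' * (Λ + (2 * δ * Real.sqrt (Λ * (CP * (Λ + 1))) + δ ^ 2 * (CP * (Λ + 1)))) + σ * (CP * (Λ + 1))) * nsqV M φ ∧
      blockSpin (Qk ∘ QvL L (fine n M) T') (SfV n L M R' G') φ ≤ blockSpin Qk (ScV n M R G) φ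
        + (ε₁ * CR * (Λ + 1) + 2 * δ' * Real.sqrt ((Λ + ε₁ * CR * (Λ + 1)) * (CP * (Λ + 1))) + δ' ^ 2 * (CP * (Λ + 1))) * nsqV M φ := by
  have hL1 : (1 : ℝ) ≤ L := by exact_mod_cast Nat.one_le_iff_ne_zero.mpr (NeZero.ne L)
  have hn0 : (0 : ℝ) < (n : ℝ) ^ d := by have := Nat.pos_of_ne_zero (NeZero.ne n); positivity
  have hnLd : (0 : ℝ) ≤ ((n : ℝ) * L) ^ d := by positivity
  have hnormW : ∀ W : Tor (fine n M) → Fin d → E, ‖W‖ ^ 2 ≤ ((n : ℝ) * L) ^ d * qWV n M W := fun W => by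
    refine (norm_sq_le_nsqV W).trans ?_
    unfold qWV
    rw [mul_pow, mul_comm ((n : ℝ) ^ d), mul_assoc, ← mul_assoc ((n : ℝ) ^ d), mul_inv_cancel₀ hn0.ne', one_mul]
    exact le_mul_of_one_le_left (nsqV_nonneg _ W) (one_le_pow₀ hL1)
  have hnormV : ∀ W' : Tor (fine L (fine n M)) → Fin d → E, ‖W'‖ ^ 2 ≤ ((n : ℝ) * L) ^ d * qVV n L M W' := fun W' => by
    have hnL : (0 : ℝ) < ((n : ℝ) * L) ^ d := by have := Nat.pos_of_ne_zero (NeZero.ne n); positivity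
    unfold qVV
    rw [← mul_assoc, mul_inv_cancel₀ hnL.ne', one_mul]
    exact norm_sq_le_nsqV W'
  have hFEDc : ∀ W', ScV n M R (fun _ => 0) (QvL L (fine n M) T' W')
      ≤ (Real.sqrt (SfV n L M R' G' W') + δ * Real.sqrt (qVV n L M W')) ^ 2 := fun W' =>
    sqrt_form_mono (SfV_zero_le n L M hG0' W') hδ (hFEDcurl W')
  exact pair_bracket_sqrt_min (V := Tor (fine L (fine n M)) → Fin d → E) (W := Tor (fine n M) → Fin d → E) (Z := Tor M → Fin d → E)
    (Qk := Qk) (Q₁ := QvL L (fine n M) T') (Sc := ScV n M R G) (Scc := ScV n M R (fun _ => 0)) (Sf := SfV n L M R' G')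
    (qW := qWV n M) (qV := qVV n L M) (qZ := nsqV M) (ρ := ρ)
    hQk (continuous_QvL L (fine n M) T') (continuous_ScV n M R hGc) (continuous_SfV n L M R' hGc') (ScV_nonneg n M R hG0) (SfV_nonneg n L M R' hG0')
    (qVV_nonneg n L M) (qWV_nonneg n M) (nsqV_nonneg M) hρ0 hnLd hΛ hCP hCR hδ hε₁ hδ' hσ hσ' hnormW hnormV hUBc hUBf hPc hPf
    hFEDc hslice (qWV_QvL_le_qVV n L M hT') hONEm hREG φ

end Vector

end Summit.QuantumFields.BalabanUV.T4Continuum.VariationalAssemblySliceMin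

end
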